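import Mathlib
import Summits.Ventures.PercRepro2.Defs
import Summits.Ventures.PercRepro2.Graph
import Summits.Ventures.PercRepro2.Events
import Summits.Ventures.PercRepro2.Exploration
import Summits.Ventures.PercRepro2.YBridge
import Summits.Ventures.PercRepro2.YDelta
import Summits.Ventures.PercRepro2.ZDelta
import Summits.Ventures.PercRepro2.ZMeanEvents

/-!
# The a₃-exploration mean-field form of the crux (ZΔ) (blind cell PercRepro2, mine-1 g7;
CONJECTURES row 2′MF, MINE-1.md §22, proofs/MINE1-MEANFIELD.md)

Explore the open cluster `A = C(a₃)`; the graph left after closing every edge touching `A` is the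
residual graph `H_A = G ∖ A` (`connDelEvent ends A u w` = `{u ↔ w in G ∖ A}`).  Three kinds of
clusters matter on `Q = {a₁ ↮ a₂}`:

* PD-type `A ∌ a₁, a₂`: then `PD = Q ∩ {a₃ ∉ C₁ ∪ C₂}` holds iff `a₁ ↮ a₂` in `H_A`, and the
  root clusters of `G` are those of `H_A`; the a₃-free shares are
  `m_x = P_{H_A}(Q, o ∈ C_x) / P_{H_A}(Q)`, `π_x = P_{H_A}(Q, b ∈ C_x) / P_{H_A}(Q)`;
* T-type `A ∋ a₂, ∌ a₁`: then `T = {a₁ ∉ C₂, a₃ ∈ C₂}` holds, `C₂ = A`, and `C₁` is the cluster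
  of `a₁` in `H_A`: `r_A = 1_{b ∈ A} − 1_{b ∉ A} P_{H_A}(b ↔ a₁)`, `m_A = 1_{o ∉ A} P_{H_A}(o ↔ a₁)`;
* T′-type `A ∋ a₁, ∌ a₂`: the mirror with `a₂` as the free root.

**`Xhat`** `:= Σ_A P(C(a₃) = A) · [PD-type: (m_L π_H + m_H π_L); T-type: m_A r_A; T′-type: m′_A r′_A]`
is the value of `X = (T_{l→h} − Δ_l) + (T_{h→l} − Δ_h)` in the model in which, conditionally on
`C(a₃)`, the root-sides of `o` and of `b` are independent with their true conditional marginals.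
The cross-cluster BHK inequality in every PD-type residual and Harris in every T/T′-type residual
give `X ≤ Xhat` (the theorem of MINE1-MEANFIELD.md §1), hence

* **`ZMean`** `:= P(PD) · Xhat ≤ [P(PD, o ∈ C₁) + P(PD, o ∈ C₂)] · W` (the crux with `X` replaced
  by `Xhat`) implies `ZDelta` — the reduction `ZDelta_of_ZMean` is the Lean target; `ZMean` itself
  is the conjecture 2′MF (census 0 / 16,168 at n = 5, 0 / 173,940 at n = 6, exact).
-/

namespace Summit.Ventures.PercRepro2

section ZMeanDefs

variable {V : Type*} {E : Type*} [Fintype E] [DecidableEq E] [Fintype V] [DecidableEq V]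
  {R : Type*} [Field R] [LinearOrder R] [IsStrictOrderedRing R]

/-- `P_{G∖W}(Q, v ∈ C_x)` — the residual mass of `{a₁ ↮ a₂, v ↔ x}`, `0` for a vertex `v` of `W`
(a vertex of the removed cluster lies in no root cluster). -/
noncomputable def delShareMass (p : E → R) (ends : E → Sym2 V) (W : Finset V) (a₁ a₂ x v : V) :
    R :=
  if v ∈ W then 0 else prob p (delQ ends W a₁ a₂ ∩ connDelEvent ends W x v)

/-- `P_{G∖W}(x ↔ v)`, `0` for a vertex `v` of `W`. -/
noncomputable def delConnProb (p : E → R) (ends : E → Sym2 V) (W : Finset V) (x v : V) : R :=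
  if v ∈ W then 0 else prob p (connDelEvent ends W x v)

/-- The PD-type term `(m_L π_H + m_H π_L)·P_{H_W}(Q)`, written with the residual masses:
`[P(Q,o∈C₁)P(Q,b∈C₂) + P(Q,o∈C₂)P(Q,b∈C₁)] / P(Q)` in `G ∖ W` (`0` if `P_{G∖W}(Q) = 0`). -/
noncomputable def termPD (p : E → R) (ends : E → Sym2 V) (W : Finset V) (o a₁ a₂ b : V) : R :=
  (delShareMass p ends W a₁ a₂ a₁ o * delShareMass p ends W a₁ a₂ a₂ b +
      delShareMass p ends W a₁ a₂ a₂ o * delShareMass p ends W a₁ a₂ a₁ b) /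
    prob p (delQ ends W a₁ a₂)

/-- The T-type term `m_W · r_W` with free root `x`: `1_{o ∉ W} P_{G∖W}(o ↔ x) ·
(1_{b ∈ W} − 1_{b ∉ W} P_{G∖W}(b ↔ x))`. -/
noncomputable def termT (p : E → R) (ends : E → Sym2 V) (W : Finset V) (o x b : V) : R :=
  delConnProb p ends W x o * (if b ∈ W then 1 else -delConnProb p ends W x b)

/-- **`X̂`**: the a₃-exploration mean-field value of `X`. -/
noncomputable def Xhat (p : E → R) (ends : E → Sym2 V) (o a₁ a₂ a₃ b : V) : R :=
  ∑ W : Finset V, prob p (clusterEvent ends a₃ (↑W : Set V)) *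
    (if a₁ ∈ W then (if a₂ ∈ W then 0 else termT p ends W o a₂ b)
      else (if a₂ ∈ W then termT p ends W o a₁ b else termPD p ends W o a₁ a₂ b))

/-- **2′MF (`ZMean`)**: the crux `(ZΔ)` with `X` replaced by its mean-field value `X̂`:
`P(PD) · X̂ ≤ [P(PD, o ∈ C₁) + P(PD, o ∈ C₂)] · W`, `W = M₂ + Δ_T`. -/
def ZMean (p : E → R) (ends : E → Sym2 V) (o a₁ a₂ a₃ b : V) : Prop :=
  prob p (PDEvent ends a₁ a₂ a₃) * Xhat p ends o a₁ a₂ a₃ b ≤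
    (prob p (PDEvent ends a₁ a₂ a₃ ∩ connEvent ends a₁ o) +
        prob p (PDEvent ends a₁ a₂ a₃ ∩ connEvent ends a₂ o)) *
      (massM2 p ends a₁ a₂ a₃ b + deltaT p ends a₁ a₂ a₃ b)

/-- The exact value of `X` as it appears in `ZDelta`. -/
noncomputable def Xexact (p : E → R) (ends : E → Sym2 V) (o a₁ a₂ a₃ b : V) : R :=
  (prob p (PDEvent ends a₁ a₂ a₃ ∩ connEvent ends a₁ o ∩ connEvent ends a₂ b) -
      deltaL p ends o a₁ a₂ a₃ b) +
    (prob p (PDEvent ends a₁ a₂ a₃ ∩ connEvent ends a₂ o ∩ connEvent ends a₁ b) -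
      deltaH p ends o a₁ a₂ a₃ b)

omit [Fintype V] [DecidableEq V] [IsStrictOrderedRing R] in
/-- `ZDelta` unfolded through `Xexact`. -/
lemma ZDelta_iff_Xexact (p : E → R) (ends : E → Sym2 V) (o a₁ a₂ a₃ b : V) :
    ZDelta p ends o a₁ a₂ a₃ b ↔
      Xexact p ends o a₁ a₂ a₃ b * prob p (PDEvent ends a₁ a₂ a₃) ≤
        (prob p (PDEvent ends a₁ a₂ a₃ ∩ connEvent ends a₁ o) +
            prob p (PDEvent ends a₁ a₂ a₃ ∩ connEvent ends a₂ o)) *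
          (massM2 p ends a₁ a₂ a₃ b + deltaT p ends a₁ a₂ a₃ b) := Iff.rfl

/-- **The reduction, modulo the mean-field bound**: if `X ≤ X̂` then `ZMean → ZDelta`
(`P(PD) ≥ 0`). The bound `X ≤ X̂` is the theorem of MINE1-MEANFIELD.md §1. -/
theorem ZDelta_of_ZMean_of_le (p : E → R) (hp : IsProbVec p) (ends : E → Sym2 V)
    (o a₁ a₂ a₃ b : V) (hX : Xexact p ends o a₁ a₂ a₃ b ≤ Xhat p ends o a₁ a₂ a₃ b)
    (h : ZMean p ends o a₁ a₂ a₃ b) : ZDelta p ends o a₁ a₂ a₃ b := by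
  rw [ZDelta_iff_Xexact]
  unfold ZMean at h
  have hD : 0 ≤ prob p (PDEvent ends a₁ a₂ a₃) := prob_nonneg hp _
  calc Xexact p ends o a₁ a₂ a₃ b * prob p (PDEvent ends a₁ a₂ a₃)
      ≤ Xhat p ends o a₁ a₂ a₃ b * prob p (PDEvent ends a₁ a₂ a₃) :=
        mul_le_mul_of_nonneg_right hX hD
    _ = prob p (PDEvent ends a₁ a₂ a₃) * Xhat p ends o a₁ a₂ a₃ b := mul_comm _ _
    _ ≤ _ := h

end ZMeanDefs

end Summit.Ventures.PercRepro2
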